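import Literature.Probability.Percolation.KSTPeriodicStatements
import Literature.Probability.Percolation.RSWProofs
import HarnessLib

/-!
# KST-type RSW for periodic measures: Lemma 3, the fences and the walls

Topic `Literature/Probability/Percolation`. Walk combinatorics for the proof of
[KohlerSchindlerTassion2023, Lemma 3 and Comment 1] (arms give quasi-crossings) in the constant
form `QuasiOfArms` of `KSTPeriodicStatements.lean`. The setting is a strip `[L, R] × [B, T]`
containing the region `H = [x₁, x₂] × [B, T]` of `m`-paths (`L < x₁`, `x₂ < R`) and two *fences*
`γ₁`, `γ₂`: top–bottom walks of `H` (translated arms), `γ₁` to the left of `γ₂`.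

* `exists_prefix_level`, `exists_prefix_downTo`, `exists_prefix_upTo`,
  `exists_openConnIn_level_downTo`, `exists_openConnIn_level_upTo`: first visit of a lattice
  walk / an open connection to a level of a coordinate (discrete intermediate value property).
* `fence_exit`: a walk of the strip starting on the top row strictly between the tops of the
  fences either meets a fence or stays inside the columns of `H` (`TopSideToLeftMeetsTB`,
  `TopSideToRightMeetsTB`).
* `fence_top`, `fence_bot`: a top–bottom walk of the strip whose bottom (resp. top) endpoint lies
  strictly between the corresponding endpoints of the fences meets a fence, or is fenced in
  (`AlternatingTBMeet` for the remaining cases).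
* `mPathAt_of_mem_support`: every vertex of an open wall (walk inside `H` from the upper to the
  lower target) lies on an open `m`-path.
* `exists_wall_top`, `exists_wall_bot`: an open connection from the row `T₀ ≥ T` down to the
  bottom row of the strip ending strictly between the feet of the fences (a translated long arm)
  produces an open wall one of whose vertices is joined to the row `T₀` (last visit to the row
  `T`, then the trichotomy above); symmetrically from the row `B₀ ≤ B` upwards.

## References

* [KohlerSchindlerTassion2023] L. Köhler-Schindler, V. Tassion, *Crossing probabilities for
  planar percolation*, Duke Math. J. 172 (2023) 809–838, §4.2 (proof of Lemma 3); Comment 1.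
-/

namespace Literature.Probability.Percolation

open LatticeModels SimpleGraph

noncomputable section

namespace KSTPeriodic

/-! ### First visit of a walk to a level -/

/-- First visit to a level of a `1`-Lipschitz function `f` along a lattice walk: a walk from `u`
with `c ≤ f u` visiting a vertex with `f ≤ c` has a prefix on which `c ≤ f`, ending at a vertex
with `f = c`. [folklore] -/
theorem exists_prefix_level (f : Site 2 → ℤ) (hf : ∀ x y : Site 2, (zdGraph 2).Adj x y → f x ≤ f y + 1)
    (c : ℤ) {u v : Site 2} (p : (zdGraph 2).Walk u v) :
    c ≤ f u → (∃ z ∈ p.support, f z ≤ c) →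
      ∃ (r : Site 2) (q : (zdGraph 2).Walk u r), f r = c ∧ (∀ z ∈ q.support, c ≤ f z) ∧
        (∀ z ∈ q.support, z ∈ p.support) ∧ ∀ e ∈ q.edges, e ∈ p.edges := by
  induction p with
  | nil =>
    intro hu hv
    rename_i u
    obtain ⟨z, hz, hzc⟩ := hv
    rw [Walk.support_nil, List.mem_singleton] at hz
    subst hz
    exact ⟨z, Walk.nil, le_antisymm hzc hu, fun w hw => by simp_all, fun w hw => hw, fun e he => he⟩
  | cons h p ih =>
    intro hu hv
    rename_i u w v
    rcases hu.eq_or_lt with hcu | hcu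
    · refine ⟨u, Walk.nil, hcu.symm, fun z hz => ?_, fun z hz => ?_, fun e he => by simp at he⟩
      · rw [Walk.support_nil, List.mem_singleton] at hz; rw [hz]; exact hu
      · rw [Walk.support_nil, List.mem_singleton] at hz; rw [hz]; exact Walk.start_mem_support _
    · have hw : c ≤ f w := by have := hf u w h; omega
      have hv' : ∃ z ∈ p.support, f z ≤ c := by
        obtain ⟨z, hz, hzc⟩ := hv
        rw [Walk.support_cons, List.mem_cons] at hz
        rcases hz with rfl | hz
        · omega
        · exact ⟨z, hz, hzc⟩
      obtain ⟨r, q, hr, hq, hs, he⟩ := ih hw hv'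
      refine ⟨r, Walk.cons h q, hr, fun z hz => ?_, fun z hz => ?_, fun e he' => ?_⟩
      · rw [Walk.support_cons, List.mem_cons] at hz
        rcases hz with rfl | hz
        · exact hu
        · exact hq z hz
      · rw [Walk.support_cons, List.mem_cons] at hz ⊢
        exact hz.imp id (hs z)
      · rw [Walk.edges_cons, List.mem_cons] at he' ⊢
        exact he'.imp id (he e)

/-- First visit downwards to the level `c` of the coordinate `i`: the prefix stays in `{c ≤ zᵢ}`
and is made of vertices and edges of the walk. [folklore] -/
theorem exists_prefix_downTo {u v : Site 2} (p : (zdGraph 2).Walk u v) (i : Fin 2) (c : ℤ)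
    (hu : c ≤ u i) (hv : ∃ z ∈ p.support, z i ≤ c) :
    ∃ (r : Site 2) (q : (zdGraph 2).Walk u r), r i = c ∧ (∀ z ∈ q.support, c ≤ z i) ∧
      (∀ z ∈ q.support, z ∈ p.support) ∧ ∀ e ∈ q.edges, e ∈ p.edges :=
  exists_prefix_level (fun z => z i) (fun _ _ h => (zdGraph_adj_apply_le h i).2) c p hu hv

/-- First visit upwards to the level `c` of the coordinate `i`: the prefix stays in `{zᵢ ≤ c}`
and is made of vertices and edges of the walk. [folklore] -/
theorem exists_prefix_upTo {u v : Site 2} (p : (zdGraph 2).Walk u v) (i : Fin 2) (c : ℤ)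
    (hu : u i ≤ c) (hv : ∃ z ∈ p.support, c ≤ z i) :
    ∃ (r : Site 2) (q : (zdGraph 2).Walk u r), r i = c ∧ (∀ z ∈ q.support, z i ≤ c) ∧
      (∀ z ∈ q.support, z ∈ p.support) ∧ ∀ e ∈ q.edges, e ∈ p.edges := by
  obtain ⟨r, q, hr, hq, hs, he⟩ := exists_prefix_level (fun z => -z i)
    (fun x y h => by have := (zdGraph_adj_apply_le h i).1; omega) (-c) p
    (by omega) (hv.imp fun z hz => ⟨hz.1, by omega⟩)
  exact ⟨r, q, by omega, fun z hz => by have := hq z hz; omega, hs, he⟩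

/-- Row/column version of `exists_openConnIn_column_ge` for either coordinate: an open connection
inside `S` from `x` with `c ≤ xᵢ` to `y` with `yᵢ ≤ c` contains an initial segment inside
`S ∩ {c ≤ zᵢ}` ending on the level `{zᵢ = c}`. [folklore] -/
theorem exists_openConnIn_level_downTo {ω : BondConfig (Site 2)} (hω : ω ⊆ (zdGraph 2).edgeSet)
    {S : Set (Site 2)} {x y : Site 2} (i : Fin 2) (c : ℤ) (hx : c ≤ x i) (hy : y i ≤ c)
    (h : ω ∈ openConnIn S x y) : ∃ z, z i = c ∧ ω ∈ openConnIn (S ∩ {w | c ≤ w i}) x z := by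
  obtain ⟨p, hpS, hpω⟩ := exists_walk_of_mem_openConnIn hω h
  obtain ⟨r, q, hr, hq, hs, he⟩ := exists_prefix_downTo p i c hx ⟨y, p.end_mem_support, hy⟩
  exact ⟨r, hr, mem_openConnIn_of_walk q (fun z hz => ⟨hpS z (hs z hz), hq z hz⟩)
    fun e he' => hpω e (he e he')⟩

/-- Row/column version of `exists_openConnIn_column` for either coordinate: an open connection
inside `S` from `x` with `xᵢ ≤ c` to `y` with `c ≤ yᵢ` contains an initial segment inside
`S ∩ {zᵢ ≤ c}` ending on the level `{zᵢ = c}`. [folklore] -/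
theorem exists_openConnIn_level_upTo {ω : BondConfig (Site 2)} (hω : ω ⊆ (zdGraph 2).edgeSet)
    {S : Set (Site 2)} {x y : Site 2} (i : Fin 2) (c : ℤ) (hx : x i ≤ c) (hy : c ≤ y i)
    (h : ω ∈ openConnIn S x y) : ∃ z, z i = c ∧ ω ∈ openConnIn (S ∩ {w | w i ≤ c}) x z := by
  obtain ⟨p, hpS, hpω⟩ := exists_walk_of_mem_openConnIn hω h
  obtain ⟨r, q, hr, hq, hs, he⟩ := exists_prefix_upTo p i c hx ⟨y, p.end_mem_support, hy⟩
  exact ⟨r, hr, mem_openConnIn_of_walk q (fun z hz => ⟨hpS z (hs z hz), hq z hz⟩)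
    fun e he' => hpω e (he e he')⟩

/-! ### Fences -/

/-- **Fenced in, or caught.** In the strip `[L, R] × [B, T]` with fences `γ₁`, `γ₂` (top–bottom
walks inside the columns `[x₁, x₂]`, `L < x₁`, `x₂ < R`): a walk of the strip starting on the top
row strictly between the tops of the fences meets one of them, or stays inside the columns
`[x₁, x₂]` — for on its way to the column `x₁ - 1` (resp. `x₂ + 1`) it would cross `γ₁`
(resp. `γ₂`) by `TopSideToLeftMeetsTB` (resp. `TopSideToRightMeetsTB`).
[cite: KohlerSchindlerTassion2023, §4.2, proof of Lemma 3] -/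
theorem fence_exit (hTL : TopSideToLeftMeetsTB) (hTR : TopSideToRightMeetsTB)
    {L R B T x₁ x₂ : ℤ} (hLx : L < x₁) (hxR : x₂ < R) (hBT : B < T)
    {g₁ h₁ g₂ h₂ s f : Site 2} (γ₁ : (zdGraph 2).Walk g₁ h₁) (γ₂ : (zdGraph 2).Walk g₂ h₂)
    (σ : (zdGraph 2).Walk s f)
    (hγ₁ : ∀ z ∈ γ₁.support, x₁ ≤ z 0 ∧ z 0 ≤ x₂ ∧ B ≤ z 1 ∧ z 1 ≤ T)
    (hγ₂ : ∀ z ∈ γ₂.support, x₁ ≤ z 0 ∧ z 0 ≤ x₂ ∧ B ≤ z 1 ∧ z 1 ≤ T)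
    (hσ : ∀ z ∈ σ.support, L ≤ z 0 ∧ z 0 ≤ R ∧ B ≤ z 1 ∧ z 1 ≤ T)
    (hg₁T : g₁ 1 = T) (hh₁B : h₁ 1 = B) (hg₂T : g₂ 1 = T) (hh₂B : h₂ 1 = B) (hsT : s 1 = T)
    (hs₁ : g₁ 0 < s 0) (hs₂ : s 0 < g₂ 0) :
    (∃ z ∈ σ.support, z ∈ γ₁.support ∨ z ∈ γ₂.support) ∨ ∀ z ∈ σ.support, x₁ ≤ z 0 ∧ z 0 ≤ x₂ := by
  by_cases hall : ∀ z ∈ σ.support, x₁ ≤ z 0 ∧ z 0 ≤ x₂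
  · exact Or.inr hall
  left
  push Not at hall
  obtain ⟨w, hw, hwx⟩ := hall
  by_cases hw₁ : x₁ ≤ w 0
  · -- the walk reaches the column `x₂ + 1`: it crosses `γ₂`
    have hw₂ : x₂ < w 0 := hwx hw₁
    have hsx : s 0 ≤ x₂ + 1 := by have := (hγ₂ g₂ γ₂.start_mem_support).2.1; omega
    obtain ⟨r, q, hr, hq, hqs, -⟩ := exists_prefix_upTo σ 0 (x₂ + 1) hsx ⟨w, hw, by omega⟩
    obtain ⟨z, hzγ, hzq⟩ := hTR L (x₂ + 1) B T g₂ h₂ s r γ₂ q hBT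
      (fun z hz => by have := hγ₂ z hz; omega)
      (fun z hz => by have := hσ z (hqs z hz); have := hq z hz; omega) hg₂T hh₂B hsT hs₂ hr
    exact ⟨z, hqs z hzq, Or.inr hzγ⟩
  · -- the walk reaches the column `x₁ - 1`: it crosses `γ₁`
    push Not at hw₁
    have hsx : x₁ - 1 ≤ s 0 := by have := (hγ₁ g₁ γ₁.start_mem_support).1; omega
    obtain ⟨r, q, hr, hq, hqs, -⟩ := exists_prefix_downTo σ 0 (x₁ - 1) hsx ⟨w, hw, by omega⟩
    obtain ⟨z, hzγ, hzq⟩ := hTL (x₁ - 1) R B T g₁ h₁ s r γ₁ q hBT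
      (fun z hz => by have := hγ₁ z hz; omega)
      (fun z hz => by have := hσ z (hqs z hz); have := hq z hz; omega) hg₁T hh₁B hsT hs₁ hr
    exact ⟨z, hqs z hzq, Or.inl hzγ⟩

/-- **Top–bottom walk with its foot between the feet of the fences.** In the strip, a walk from the
top row to the bottom row whose bottom endpoint lies strictly between the feet of the fences meets
a fence, or starts strictly between their tops and stays inside the columns `[x₁, x₂]`
(`AlternatingTBMeet` when the top endpoint is not between the tops, `fence_exit` otherwise).
[cite: KohlerSchindlerTassion2023, §4.2, proof of Lemma 3] -/
theorem fence_top (hTL : TopSideToLeftMeetsTB) (hTR : TopSideToRightMeetsTB) (hAlt : AlternatingTBMeet)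
    {L R B T x₁ x₂ : ℤ} (hLx : L < x₁) (hxR : x₂ < R) (hBT : B < T)
    {g₁ h₁ g₂ h₂ s f : Site 2} (γ₁ : (zdGraph 2).Walk g₁ h₁) (γ₂ : (zdGraph 2).Walk g₂ h₂)
    (σ : (zdGraph 2).Walk s f)
    (hγ₁ : ∀ z ∈ γ₁.support, x₁ ≤ z 0 ∧ z 0 ≤ x₂ ∧ B ≤ z 1 ∧ z 1 ≤ T)
    (hγ₂ : ∀ z ∈ γ₂.support, x₁ ≤ z 0 ∧ z 0 ≤ x₂ ∧ B ≤ z 1 ∧ z 1 ≤ T)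
    (hσ : ∀ z ∈ σ.support, L ≤ z 0 ∧ z 0 ≤ R ∧ B ≤ z 1 ∧ z 1 ≤ T)
    (hg₁T : g₁ 1 = T) (hh₁B : h₁ 1 = B) (hg₂T : g₂ 1 = T) (hh₂B : h₂ 1 = B) (hsT : s 1 = T)
    (hfB : f 1 = B) (hf₁ : h₁ 0 < f 0) (hf₂ : f 0 < h₂ 0) :
    (∃ z ∈ σ.support, z ∈ γ₁.support ∨ z ∈ γ₂.support) ∨
      ((g₁ 0 < s 0 ∧ s 0 < g₂ 0) ∧ ∀ z ∈ σ.support, x₁ ≤ z 0 ∧ z 0 ≤ x₂) := by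
  have hγ₁' : ∀ z ∈ γ₁.support, L ≤ z 0 ∧ z 0 ≤ R ∧ B ≤ z 1 ∧ z 1 ≤ T := fun z hz => by
    have := hγ₁ z hz; omega
  have hγ₂' : ∀ z ∈ γ₂.support, L ≤ z 0 ∧ z 0 ≤ R ∧ B ≤ z 1 ∧ z 1 ≤ T := fun z hz => by
    have := hγ₂ z hz; omega
  rcases lt_trichotomy (s 0) (g₁ 0) with h1 | h1 | h1
  · obtain ⟨z, hzγ, hzσ⟩ := hAlt L R B T g₁ h₁ s f γ₁ σ hBT hγ₁' hσ hg₁T hh₁B hsT hfB (Or.inl ⟨h1, hf₁⟩)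
    exact Or.inl ⟨z, hzσ, Or.inl hzγ⟩
  · have hs : s = g₁ := Site.eq_iff_two.2 ⟨h1, by rw [hsT, hg₁T]⟩
    exact Or.inl ⟨s, σ.start_mem_support, Or.inl (by rw [hs]; exact γ₁.start_mem_support)⟩
  rcases lt_trichotomy (s 0) (g₂ 0) with h2 | h2 | h2
  · rcases fence_exit hTL hTR hLx hxR hBT γ₁ γ₂ σ hγ₁ hγ₂ hσ hg₁T hh₁B hg₂T hh₂B hsT h1 h2 with h | h
    · exact Or.inl h
    · exact Or.inr ⟨⟨h1, h2⟩, h⟩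
  · have hs : s = g₂ := Site.eq_iff_two.2 ⟨h2, by rw [hsT, hg₂T]⟩
    exact Or.inl ⟨s, σ.start_mem_support, Or.inr (by rw [hs]; exact γ₂.start_mem_support)⟩
  · obtain ⟨z, hzγ, hzσ⟩ := hAlt L R B T g₂ h₂ s f γ₂ σ hBT hγ₂' hσ hg₂T hh₂B hsT hfB (Or.inr ⟨h2, hf₂⟩)
    exact Or.inl ⟨z, hzσ, Or.inr hzγ⟩

/-- **Top–bottom walk with its top between the tops of the fences.** In the strip, a walk from the
top row to the bottom row whose top endpoint lies strictly between the tops of the fences meets a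
fence, or ends strictly between their feet and stays inside the columns `[x₁, x₂]`.
[cite: KohlerSchindlerTassion2023, §4.2, proof of Lemma 3] -/
theorem fence_bot (hTL : TopSideToLeftMeetsTB) (hTR : TopSideToRightMeetsTB) (hAlt : AlternatingTBMeet)
    {L R B T x₁ x₂ : ℤ} (hLx : L < x₁) (hxR : x₂ < R) (hBT : B < T)
    {g₁ h₁ g₂ h₂ s f : Site 2} (γ₁ : (zdGraph 2).Walk g₁ h₁) (γ₂ : (zdGraph 2).Walk g₂ h₂)
    (σ : (zdGraph 2).Walk s f)
    (hγ₁ : ∀ z ∈ γ₁.support, x₁ ≤ z 0 ∧ z 0 ≤ x₂ ∧ B ≤ z 1 ∧ z 1 ≤ T)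
    (hγ₂ : ∀ z ∈ γ₂.support, x₁ ≤ z 0 ∧ z 0 ≤ x₂ ∧ B ≤ z 1 ∧ z 1 ≤ T)
    (hσ : ∀ z ∈ σ.support, L ≤ z 0 ∧ z 0 ≤ R ∧ B ≤ z 1 ∧ z 1 ≤ T)
    (hg₁T : g₁ 1 = T) (hh₁B : h₁ 1 = B) (hg₂T : g₂ 1 = T) (hh₂B : h₂ 1 = B) (hsT : s 1 = T)
    (hfB : f 1 = B) (hs₁ : g₁ 0 < s 0) (hs₂ : s 0 < g₂ 0) :
    (∃ z ∈ σ.support, z ∈ γ₁.support ∨ z ∈ γ₂.support) ∨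
      ((h₁ 0 < f 0 ∧ f 0 < h₂ 0) ∧ ∀ z ∈ σ.support, x₁ ≤ z 0 ∧ z 0 ≤ x₂) := by
  have hγ₁' : ∀ z ∈ γ₁.support, L ≤ z 0 ∧ z 0 ≤ R ∧ B ≤ z 1 ∧ z 1 ≤ T := fun z hz => by
    have := hγ₁ z hz; omega
  have hγ₂' : ∀ z ∈ γ₂.support, L ≤ z 0 ∧ z 0 ≤ R ∧ B ≤ z 1 ∧ z 1 ≤ T := fun z hz => by
    have := hγ₂ z hz; omega
  rcases lt_trichotomy (f 0) (h₁ 0) with e1 | e1 | e1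
  · obtain ⟨z, hzγ, hzσ⟩ := hAlt L R B T g₁ h₁ s f γ₁ σ hBT hγ₁' hσ hg₁T hh₁B hsT hfB (Or.inr ⟨hs₁, e1⟩)
    exact Or.inl ⟨z, hzσ, Or.inl hzγ⟩
  · have hf : f = h₁ := Site.eq_iff_two.2 ⟨e1, by rw [hfB, hh₁B]⟩
    exact Or.inl ⟨f, σ.end_mem_support, Or.inl (by rw [hf]; exact γ₁.end_mem_support)⟩
  rcases lt_trichotomy (f 0) (h₂ 0) with e2 | e2 | e2
  · rcases fence_exit hTL hTR hLx hxR hBT γ₁ γ₂ σ hγ₁ hγ₂ hσ hg₁T hh₁B hg₂T hh₂B hsT hs₁ hs₂ with h | h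
    · exact Or.inl h
    · exact Or.inr ⟨⟨e1, e2⟩, h⟩
  · have hf : f = h₂ := Site.eq_iff_two.2 ⟨e2, by rw [hfB, hh₂B]⟩
    exact Or.inl ⟨f, σ.end_mem_support, Or.inr (by rw [hf]; exact γ₂.end_mem_support)⟩
  · obtain ⟨z, hzγ, hzσ⟩ := hAlt L R B T g₂ h₂ s f γ₂ σ hBT hγ₂' hσ hg₂T hh₂B hsT hfB (Or.inl ⟨hs₂, e2⟩)
    exact Or.inl ⟨z, hzσ, Or.inr hzγ⟩

/-! ### Walls -/

/-- Every vertex of an open wall — an open walk inside `H = R_t(m + b, m)` from the upper target to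
the lower target — lies on an open `m`-path. [cite: KohlerSchindlerTassion2023, §4.1] -/
theorem mPathAt_of_mem_support {ω : BondConfig (Site 2)} {t b m : ℕ} {g h : Site 2}
    (W : (zdGraph 2).Walk g h) (hg : g ∈ upperTarget t b m) (hh : h ∈ upperTarget t b (-(m : ℤ) - t))
    (hWS : ∀ x ∈ W.support, x ∈ mRegion t b m) (hWω : ∀ e ∈ W.edges, e ∈ ω) {z : Site 2}
    (hz : z ∈ W.support) : MPathAt t b m ω z := by
  classical
  refine ⟨⟨g, hg, ?_⟩, ⟨h, hh, ?_⟩⟩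
  · rw [openConnIn_comm]; exact mem_openConnIn_of_mem_support W hWS hWω hz
  · have hz' : z ∈ W.reverse.support := by rw [Walk.support_reverse, List.mem_reverse]; exact hz
    rw [openConnIn_comm]
    refine mem_openConnIn_of_mem_support W.reverse (fun x hx => hWS x ?_) (fun e he => hWω e ?_) hz'
    · rw [Walk.support_reverse, List.mem_reverse] at hx; exact hx
    · rw [Walk.edges_reverse, List.mem_reverse] at he; exact he

/-- **A wall joined to the top row.** Strip `[L, R] × [B, T]` with fences `γ₁`, `γ₂` inside
`[x₁, x₂] × [B, T]` whose endpoints lie in the targets `[u₁, u₂] × {T}`, `[u₁, u₂] × {B}`; an open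
connection inside `[L, R] × [B, T₀]` (`T ≤ T₀`) from the row `T₀` to a point of the row `B`
strictly between the feet of the fences. Then there is an open wall (a walk inside
`[x₁, x₂] × [B, T]` between the targets, with open edges) one of whose vertices is joined inside
`[L, R] × [B₀, T₀]` to the starting point on the row `T₀`: the part of the connection after its
last visit to the row `T` either meets a fence (which is then the wall) or is itself a wall
(`fence_top`). [cite: KohlerSchindlerTassion2023, §4.2, proof of Lemma 3] -/
theorem exists_wall_top (hTL : TopSideToLeftMeetsTB) (hTR : TopSideToRightMeetsTB)
    (hAlt : AlternatingTBMeet) {ω : BondConfig (Site 2)} (hω : ω ⊆ (zdGraph 2).edgeSet)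
    {L R B₀ B T T₀ x₁ x₂ u₁ u₂ : ℤ} (hLx : L < x₁) (hxR : x₂ < R) (hBT : B < T) (hB₀ : B₀ ≤ B)
    (hT₀ : T ≤ T₀) {g₁ h₁ g₂ h₂ : Site 2} (γ₁ : (zdGraph 2).Walk g₁ h₁) (γ₂ : (zdGraph 2).Walk g₂ h₂)
    (hγ₁ : ∀ z ∈ γ₁.support, x₁ ≤ z 0 ∧ z 0 ≤ x₂ ∧ B ≤ z 1 ∧ z 1 ≤ T) (hγ₁ω : ∀ e ∈ γ₁.edges, e ∈ ω)
    (hg₁ : u₁ ≤ g₁ 0 ∧ g₁ 0 ≤ u₂ ∧ g₁ 1 = T) (hh₁ : u₁ ≤ h₁ 0 ∧ h₁ 0 ≤ u₂ ∧ h₁ 1 = B)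
    (hγ₂ : ∀ z ∈ γ₂.support, x₁ ≤ z 0 ∧ z 0 ≤ x₂ ∧ B ≤ z 1 ∧ z 1 ≤ T) (hγ₂ω : ∀ e ∈ γ₂.edges, e ∈ ω)
    (hg₂ : u₁ ≤ g₂ 0 ∧ g₂ 0 ≤ u₂ ∧ g₂ 1 = T) (hh₂ : u₁ ≤ h₂ 0 ∧ h₂ 0 ≤ u₂ ∧ h₂ 1 = B)
    {x y : Site 2} (hx : x 1 = T₀) (hy : y 1 = B) (hy₁ : h₁ 0 < y 0) (hy₂ : y 0 < h₂ 0)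
    (hxy : ω ∈ openConnIn (rect L R B T₀) x y) :
    ∃ (g h : Site 2) (W : (zdGraph 2).Walk g h), (u₁ ≤ g 0 ∧ g 0 ≤ u₂ ∧ g 1 = T) ∧
      (u₁ ≤ h 0 ∧ h 0 ≤ u₂ ∧ h 1 = B) ∧ (∀ z ∈ W.support, x₁ ≤ z 0 ∧ z 0 ≤ x₂ ∧ B ≤ z 1 ∧ z 1 ≤ T) ∧
      (∀ e ∈ W.edges, e ∈ ω) ∧ ∃ c ∈ W.support, ω ∈ openConnIn (rect L R B₀ T₀) c x := by
  classical
  -- the part of the connection after its last visit to the row `T`, seen from `y`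
  have hyx : ω ∈ openConnIn (rect L R B T₀) y x := by rwa [openConnIn_comm]
  obtain ⟨s, hsT, hys⟩ := exists_openConnIn_level_upTo hω 1 T (by omega) (by omega) hyx
  have hsub : rect L R B T₀ ∩ {w : Site 2 | w 1 ≤ T} ⊆ rect L R B T :=
    fun w hw => ⟨hw.1.1, hw.1.2.1, hw.1.2.2.1, hw.2⟩
  obtain ⟨τ, hτS, hτω⟩ := exists_walk_of_mem_openConnIn hω (openConnIn_mono hsub _ _ hys)
  have hbig₁ : rect L R B T ⊆ rect L R B₀ T₀ := rect_mono le_rfl le_rfl hB₀ hT₀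
  have hbig₂ : rect L R B T₀ ⊆ rect L R B₀ T₀ := rect_mono le_rfl le_rfl hB₀ le_rfl
  -- every vertex of `τ` is joined to `x` inside the big box
  have hjoin : ∀ z ∈ τ.support, ω ∈ openConnIn (rect L R B₀ T₀) z x := by
    intro z hz
    have h1 : ω ∈ openConnIn (rect L R B T) y z := mem_openConnIn_of_mem_support τ hτS hτω hz
    rw [openConnIn_comm] at h1
    exact PlanarDuality.openConnIn_trans (openConnIn_mono hbig₁ _ _ h1) (openConnIn_mono hbig₂ _ _ hyx)
  have hτ'S : ∀ z ∈ τ.reverse.support, L ≤ z 0 ∧ z 0 ≤ R ∧ B ≤ z 1 ∧ z 1 ≤ T := by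
    intro z hz
    rw [Walk.support_reverse, List.mem_reverse] at hz
    exact hτS z hz
  rcases fence_top hTL hTR hAlt hLx hxR hBT γ₁ γ₂ τ.reverse hγ₁ hγ₂ hτ'S hg₁.2.2 hh₁.2.2 hg₂.2.2
    hh₂.2.2 hsT hy hy₁ hy₂ with ⟨z, hz, hzγ | hzγ⟩ | ⟨⟨hs₁, hs₂⟩, hin⟩
  · have hz' : z ∈ τ.support := by rw [Walk.support_reverse, List.mem_reverse] at hz; exact hz
    exact ⟨g₁, h₁, γ₁, hg₁, hh₁, hγ₁, hγ₁ω, z, hzγ, hjoin z hz'⟩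
  · have hz' : z ∈ τ.support := by rw [Walk.support_reverse, List.mem_reverse] at hz; exact hz
    exact ⟨g₂, h₂, γ₂, hg₂, hh₂, hγ₂, hγ₂ω, z, hzγ, hjoin z hz'⟩
  · refine ⟨s, y, τ.reverse, ⟨by omega, by omega, hsT⟩, ⟨by omega, by omega, hy⟩,
      fun z hz => ⟨(hin z hz).1, (hin z hz).2, (hτ'S z hz).2.2.1, (hτ'S z hz).2.2.2⟩, ?_,
      s, τ.reverse.start_mem_support, hjoin s τ.end_mem_support⟩
    intro e he
    rw [Walk.edges_reverse, List.mem_reverse] at he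
    exact hτω e he

/-- **A wall joined to the bottom row.** Mirror image of `exists_wall_top`: an open connection
inside `[L, R] × [B₀, T]` (`B₀ ≤ B`) from a point of the row `T` strictly between the tops of the
fences down to the row `B₀` produces an open wall one of whose vertices is joined inside
`[L, R] × [B₀, T₀]` to the endpoint on the row `B₀` (first visit to the row `B`, `fence_bot`).
[cite: KohlerSchindlerTassion2023, §4.2, proof of Lemma 3] -/
theorem exists_wall_bot (hTL : TopSideToLeftMeetsTB) (hTR : TopSideToRightMeetsTB)
    (hAlt : AlternatingTBMeet) {ω : BondConfig (Site 2)} (hω : ω ⊆ (zdGraph 2).edgeSet)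
    {L R B₀ B T T₀ x₁ x₂ u₁ u₂ : ℤ} (hLx : L < x₁) (hxR : x₂ < R) (hBT : B < T) (hB₀ : B₀ ≤ B)
    (hT₀ : T ≤ T₀) {g₁ h₁ g₂ h₂ : Site 2} (γ₁ : (zdGraph 2).Walk g₁ h₁) (γ₂ : (zdGraph 2).Walk g₂ h₂)
    (hγ₁ : ∀ z ∈ γ₁.support, x₁ ≤ z 0 ∧ z 0 ≤ x₂ ∧ B ≤ z 1 ∧ z 1 ≤ T) (hγ₁ω : ∀ e ∈ γ₁.edges, e ∈ ω)
    (hg₁ : u₁ ≤ g₁ 0 ∧ g₁ 0 ≤ u₂ ∧ g₁ 1 = T) (hh₁ : u₁ ≤ h₁ 0 ∧ h₁ 0 ≤ u₂ ∧ h₁ 1 = B)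
    (hγ₂ : ∀ z ∈ γ₂.support, x₁ ≤ z 0 ∧ z 0 ≤ x₂ ∧ B ≤ z 1 ∧ z 1 ≤ T) (hγ₂ω : ∀ e ∈ γ₂.edges, e ∈ ω)
    (hg₂ : u₁ ≤ g₂ 0 ∧ g₂ 0 ≤ u₂ ∧ g₂ 1 = T) (hh₂ : u₁ ≤ h₂ 0 ∧ h₂ 0 ≤ u₂ ∧ h₂ 1 = B)
    {x y : Site 2} (hx : x 1 = T) (hx₁ : g₁ 0 < x 0) (hx₂ : x 0 < g₂ 0) (hy : y 1 = B₀)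
    (hxy : ω ∈ openConnIn (rect L R B₀ T) x y) :
    ∃ (g h : Site 2) (W : (zdGraph 2).Walk g h), (u₁ ≤ g 0 ∧ g 0 ≤ u₂ ∧ g 1 = T) ∧
      (u₁ ≤ h 0 ∧ h 0 ≤ u₂ ∧ h 1 = B) ∧ (∀ z ∈ W.support, x₁ ≤ z 0 ∧ z 0 ≤ x₂ ∧ B ≤ z 1 ∧ z 1 ≤ T) ∧
      (∀ e ∈ W.edges, e ∈ ω) ∧ ∃ c ∈ W.support, ω ∈ openConnIn (rect L R B₀ T₀) c y := by
  classical
  -- the part of the connection before its first visit to the row `B`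
  obtain ⟨f, hfB, hxf⟩ := exists_openConnIn_level_downTo hω 1 B (by omega) (by omega) hxy
  have hsub : rect L R B₀ T ∩ {w : Site 2 | B ≤ w 1} ⊆ rect L R B T :=
    fun w hw => ⟨hw.1.1, hw.1.2.1, hw.2, hw.1.2.2.2⟩
  obtain ⟨τ, hτS, hτω⟩ := exists_walk_of_mem_openConnIn hω (openConnIn_mono hsub _ _ hxf)
  have hbig₁ : rect L R B T ⊆ rect L R B₀ T₀ := rect_mono le_rfl le_rfl hB₀ hT₀
  have hbig₂ : rect L R B₀ T ⊆ rect L R B₀ T₀ := rect_mono le_rfl le_rfl le_rfl hT₀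
  -- every vertex of `τ` is joined to `y` inside the big box
  have hjoin : ∀ z ∈ τ.support, ω ∈ openConnIn (rect L R B₀ T₀) z y := by
    intro z hz
    have h1 : ω ∈ openConnIn (rect L R B T) x z := mem_openConnIn_of_mem_support τ hτS hτω hz
    rw [openConnIn_comm] at h1
    exact PlanarDuality.openConnIn_trans (openConnIn_mono hbig₁ _ _ h1) (openConnIn_mono hbig₂ _ _ hxy)
  have hτS' : ∀ z ∈ τ.support, L ≤ z 0 ∧ z 0 ≤ R ∧ B ≤ z 1 ∧ z 1 ≤ T := fun z hz => hτS z hz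
  rcases fence_bot hTL hTR hAlt hLx hxR hBT γ₁ γ₂ τ hγ₁ hγ₂ hτS' hg₁.2.2 hh₁.2.2 hg₂.2.2 hh₂.2.2 hx
    hfB hx₁ hx₂ with ⟨z, hz, hzγ | hzγ⟩ | ⟨⟨hf₁, hf₂⟩, hin⟩
  · exact ⟨g₁, h₁, γ₁, hg₁, hh₁, hγ₁, hγ₁ω, z, hzγ, hjoin z hz⟩
  · exact ⟨g₂, h₂, γ₂, hg₂, hh₂, hγ₂, hγ₂ω, z, hzγ, hjoin z hz⟩
  · exact ⟨x, f, τ, ⟨by omega, by omega, hx⟩, ⟨by omega, by omega, hfB⟩,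
      fun z hz => ⟨(hin z hz).1, (hin z hz).2, (hτS' z hz).2.2.1, (hτS' z hz).2.2.2⟩, hτω,
      x, τ.start_mem_support, hjoin x τ.start_mem_support⟩

end KSTPeriodic

end

end Literature.Probability.Percolation
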